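import Summits.QuantumFields.BalabanUV.Beta.GAN24.ExponentialChartMixedCovariantTaylor

/-!
# `BalabanUV.Beta.GAN24.ExponentialChartPolarisation` — binder row G-an2-4 ∕ (CONV-C), route R7 «TWO CURRENCIES», PART 255: POLARISATION — THE MIXED SECOND PARTIAL OF THE INVERSE
# EFFECTIVE COVARIANCE IN THE CHART `U_{s,r} = exp(iη(sA + rB))` IS HALF THE POLARISATION OF PART 247's SECOND DERIVATIVES ALONG `A + B`, `A`, `B`:
# `∂_r|₀∂_s|₀F(e^{iη(sA+rB)}) = ½(∂²_s|₀F(e^{isη(A+B)}) − ∂²_s|₀F(e^{isηA}) − ∂²_s|₀F(e^{isηB}))` for `F(U) = (L^{dk}Q_k(Δ_a^{(k)} + (Δ^U − Δ^1))⁻¹Q_kᴴ)⁻¹`, every volume, every level, ANY two real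
# connections (no Lipschitz hypothesis: an identity of finite-dimensional calculus).  With PART 254 (the END of the left side) and PART 247 at `N = 2` (the END of each term on the right) the
# one-loop vacuum-polarisation tensor of the exact abelian covariant vector Laplacian in Bałaban's chart is a symmetric bilinear form every entry of which has the β-cell's `LimitRate` END on
# `ℤ^d`.  PART 251 §4 (`deriv_deriv_eq_half_polarisation`) on PART 252's partial jets and the three entrywise-`C^∞` jet towers of PART 242's shape; the jet relations `a + b` and `a₂ + 2c + b₂`
# are PART 253 §3 (unit b2b-balaban-gan24-p3, gen 66; v1; generator `HOME/b2b-balaban-gan24-p3/gen66/records/gen/gen255.py`)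

NOT IN PRINT; OUR PROOF ([folklore] bookkeeping BY NAME over PART 251 (`deriv_deriv_eq_half_polarisation`), PART 252 (`hasDerivAt_covPert_expChart₂_fst`, `mixedLetter_fst_zero`,
`hasDerivAt_covPert_expChart₂_snd_zero`, `hasDerivAt_mixedLetter`, `covPert_expChart₂_zero_zero`, `expChart₂_snd_zero ∕ _fst_zero ∕ _diag`), PART 253 (`jetV_one_expChart`, `jetV_one_add`,
`jetV_two_add`, `jetZ_two_add`, `Pmodel_add'`, `couplingLetter_add`, `couplingLetter_two_mul`), PART 247 (`expJetV_eq`, `expJetZ_eq`, `expJetZ_eq_zero_one`), PART 245 (`contDiff_expChart_entry`),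
PART 242 (`contDiff_conn`, `contDiff_zfield`, `hasDerivAt_iteratedDeriv_scalar`), PART 241 (`hasDerivAt_couplingLetter_curve`), PART 161 (`exists_clm_avgTow`), PART 118, `isUnit_det_calDalev`,
`calDalev_inv`, NE2's `covPert_eq`; [Balaban1985BackgroundPropagators] (3.3) p. 390, (3.35) p. 396 and [Balaban1987RG1] (1.20)–(1.22) p. 264 LOCATE the shapes; nothing printed is a hypothesis).
HONEST FRAMING (cell contract, verbatim): «discharging `BetaPertH` makes Bałaban's UV stability UNCONDITIONAL — a real constructive-QFT result; it is NOT the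
continuum limit and NOT the Clay problem.»  HONEST DEPENDENCY (verbatim): «continuum YM on T⁴ ⇐ BetaPertH ∧ nine spine estimates (0/9 proved); BetaPertH ⇐
(D1) ∧ (D4) ∧ CAP+tail; G-an2-4 gates asym, D1 and NE2/3/4.»

WHAT THIS FILE PROVES (0 sorry, 0 `def`; `U^{A,B}_{s,r} k ν x = exp((I·A k ν x∕n_k)·s + (I·B k ν x∕n_k)·r)`, `U^X_s k ν x = exp((I·X k ν x∕n_k)·s)`, `A, B` REAL, every volume `M`, every level `k`):
* **`deriv_deriv_invCov_expChart₂_eq_half_polarisation`**: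
  `∂_r|₀∂_s|₀[(L^{dk}Q_k(Δ_a^{(k)} + covPert U^{A,B}_{s,r} k)⁻¹Q_kᴴ)⁻¹] = ½·(∂²_s|₀[… covPert U^{A+B}_s …] − ∂²_s|₀[… covPert U^A_s …] − ∂²_s|₀[… covPert U^B_s …])`.
WHAT IT DOES NOT DO: the END (PART 254 for the left side, PART 247 at `N = 2` for the right); Bałaban's `−∂P∂*` ∕ `aQ(U)*Q(U)` parts and the non-abelian colour structure; base points other than
`U = 1`.  SUPPLIER work; NEVER «G-an2-4 closed»; NOT (CONV-C), NOT D1, NOT `BetaPertH`, NOT continuum, NOT Clay.  Records: `HOME/b2b-balaban-gan24-p3/gen66/README.md`.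
-/

noncomputable section

open scoped BigOperators ComplexConjugate Matrix Matrix.Norms.L2Operator
open Filter Topology

namespace Summit.QuantumFields.BalabanUV.Beta.GAN24.ExponentialChartPolarisation

open Literature.MathematicalPhysics.QuantumFieldTheory.Balaban1983to89
open Literature.MathematicalPhysics.QuantumFieldTheory.Balaban1983to89.B5Prop11Plancherel (Tor fine)
open Literature.MathematicalPhysics.QuantumFieldTheory.Balaban1983to89.B5G183RateUnitTower (lev)
open Summit.QuantumFields.BalabanUV.T4Continuum
open Summit.QuantumFields.BalabanUV.T4Continuum.CovariantAveragingTower (avgTow)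
open Summit.QuantumFields.BalabanUV.T4Continuum.BalabanAveragedTowerUnit (idx QBlev calGlev unitCovB)
open Summit.QuantumFields.BalabanUV.T4Continuum.KingPairingPlantedLaw (calDalev calDalev_inv isUnit_det_calDalev)
open Summit.QuantumFields.BalabanUV.T4Continuum.FirstOrderBackgroundModel (Pmodel)
open Summit.QuantumFields.BalabanUV.T4Continuum.AbelianCovariantLaplacian (covPert connV zT covPert_eq negConn)
open Summit.QuantumFields.BalabanUV.Beta.GAN24.EffectiveFormInsertionLaw (isUnit_det_unitCovB_and_opNorm_inv_le)
open Summit.QuantumFields.BalabanUV.Beta.GAN24.BackgroundExpansionTaylor (exists_clm_avgTow)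
open Summit.QuantumFields.BalabanUV.Beta.GAN24.CouplingCurveTaylor (hasDerivAt_couplingLetter_curve)
open Summit.QuantumFields.BalabanUV.Beta.GAN24.CovariantCurveTaylor (contDiff_conn contDiff_zfield hasDerivAt_iteratedDeriv_scalar)
open Summit.QuantumFields.BalabanUV.Beta.GAN24.ExponentialChartJets (contDiff_expChart_entry)
open Summit.QuantumFields.BalabanUV.Beta.GAN24.ExponentialChartCovariantTaylor (expJetV_eq expJetZ_eq expJetZ_eq_zero_one)
open Summit.QuantumFields.BalabanUV.Beta.GAN24.ResolventMixedPartials (deriv_deriv_eq_half_polarisation)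
open Summit.QuantumFields.BalabanUV.Beta.GAN24.ExponentialChartMixedJets (hasDerivAt_covPert_expChart₂_fst mixedLetter_fst_zero hasDerivAt_covPert_expChart₂_snd_zero
  hasDerivAt_mixedLetter covPert_expChart₂_zero_zero expChart₂_snd_zero expChart₂_fst_zero expChart₂_diag)
open Summit.QuantumFields.BalabanUV.Beta.GAN24.ExponentialChartMixedBackgrounds (jetV_one_expChart jetV_one_add jetV_two_add jetZ_two_add Pmodel_add' couplingLetter_add
  couplingLetter_two_mul)

variable {d : ℕ} (L : ℕ) [NeZero L] (M : Fin d → ℕ) [hM : ∀ μ, NeZero (M μ)] (a : ℝ) (ha : 0 < a)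

/-- **`deriv_deriv_invCov_expChart₂_eq_half_polarisation` — POLARISATION OF THE ONE-LOOP HESSIAN** [our proof]: for every volume, every level `k` and ANY two real connections `A,
      B`,
`∂_r|₀∂_s|₀[(L^{dk}Q_k(Δ_a^{(k)} + covPert U^{A,B}_{s,r} k)⁻¹Q_kᴴ)⁻¹] = ½·(∂²_s|₀` along the exponential chart of `A + B` `−` along the chart of `A` `−` along the chart of `B)`,
      the right side
in PART 247's literal shape (`N = 2`).  PART 251 §4 with: the two-parameter data of PART 252 (`h10 ∕ ha ∕ h01 ∕ h11`), the three one-parameter jet towers of entrywise iterated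
      derivatives
(PART 242's shape: `contDiff_conn ∕ contDiff_zfield ∕ contDiff_expChart_entry ∕ hasDerivAt_iteratedDeriv_scalar ∕ hasDerivAt_couplingLetter_curve`), the base point `U = 1`
(`expChart₂_snd_zero ∕ _fst_zero ∕ _diag`, `covPert_eq`), the first jets `−iA`, `−iB`, `−i(A + B) = −iA + (−iB)` (PART 253's `jetV_one_expChart ∕ jetV_one_add`, PART 247's
      `expJetZ_eq_zero_one`)
and the second jets `a₂ + 2c + b₂` (PART 247's `expJetV_eq ∕ expJetZ_eq`, PART 253's `jetV_two_add ∕ jetZ_two_add ∕ couplingLetter_add ∕ couplingLetter_two_mul`).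
[cite: Balaban1985BackgroundPropagators, (3.3) p.390, (3.35) p.396 (shapes); Balaban1987RG1, (1.20)–(1.22) p.264 (shapes)] -/
theorem deriv_deriv_invCov_expChart₂_eq_half_polarisation (A B : (k : ℕ) → Fin d → (idx L M k → ℝ)) (k : ℕ) :
    deriv (fun r : ℝ => deriv (fun s : ℝ => (avgTow (QBlev L M) ((L : ℝ) ^ d)
        (fun k' => (calDalev L M a ha k' + covPert L M (fun k'' ν' (x' : idx L M k'') => Complex.exp ((Complex.I * (A k'' ν' x' : ℂ) / ((lev L k'' : ℕ) : ℂ)) * ((s : ℝ) : ℂ) +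
              (Complex.I * (B k'' ν' x' : ℂ) / ((lev L k'' : ℕ) : ℂ)) * ((r : ℝ) : ℂ))) k')⁻¹) k)⁻¹) 0) 0
      = (1 / 2 : ℂ) • (iteratedDeriv 2 (fun s : ℝ => (avgTow (QBlev L M) ((L : ℝ) ^ d)
          (fun k' => (calDalev L M a ha k' + covPert L M (fun k'' ν' (x' : idx L M k'') => Complex.exp ((Complex.I * ((A k'' ν' x' + B k'' ν' x' : ℝ) : ℂ) / ((lev L k'' : ℕ) : ℂ))
                * ((s : ℝ) : ℂ))) k')⁻¹) k)⁻¹) 0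
          - iteratedDeriv 2 (fun s : ℝ => (avgTow (QBlev L M) ((L : ℝ) ^ d)
          (fun k' => (calDalev L M a ha k' + covPert L M (fun k'' ν' (x' : idx L M k'') => Complex.exp ((Complex.I * ((A k'' ν' x' : ℝ) : ℂ) / ((lev L k'' : ℕ) : ℂ)) * ((s : ℝ) :
                ℂ))) k')⁻¹) k)⁻¹) 0
          - iteratedDeriv 2 (fun s : ℝ => (avgTow (QBlev L M) ((L : ℝ) ^ d)
          (fun k' => (calDalev L M a ha k' + covPert L M (fun k'' ν' (x' : idx L M k'') => Complex.exp ((Complex.I * ((B k'' ν' x' : ℝ) : ℂ) / ((lev L k'' : ℕ) : ℂ)) * ((s : ℝ) :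
                ℂ))) k')⁻¹) k)⁻¹) 0) := by
  obtain ⟨Φ, hΦ⟩ := exists_clm_avgTow (QBlev L M) ((L : ℝ) ^ d) k
  -- the three one-parameter jet towers of entrywise iterated derivatives (PART 242's shape), uniformly in the real connection `X`
  have hcV : ∀ (X : (k : ℕ) → Fin d → (idx L M k → ℝ)) (k' : ℕ) (ν : Fin d) (x : idx L M k') (n : ℕ),
      ContDiff ℝ n (fun s : ℝ => connV L M (fun k'' ν' (x' : idx L M k'') => Complex.exp ((Complex.I * ((X k'' ν' x' : ℝ) : ℂ) / ((lev L k'' : ℕ) : ℂ)) * ((s : ℝ) : ℂ))) k' ν x)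
            := by
    intro X k' ν x n
    simp only [connV, negConn]
    exact (contDiff_conn (fine (lev L k') M) (u := fun s : ℝ => (fun k'' ν' (x' : idx L M k'') => Complex.exp ((Complex.I * ((X k'' ν' x' : ℝ) : ℂ) / ((lev L k'' : ℕ) : ℂ)) * ((s
          : ℝ) : ℂ))) k') (fun ν' i => contDiff_expChart_entry _ n) _ ν x).neg
  have hcZ : ∀ (X : (k : ℕ) → Fin d → (idx L M k → ℝ)) (k' : ℕ) (x : idx L M k') (n : ℕ),
      ContDiff ℝ n (fun s : ℝ => zT L M (fun k'' ν' (x' : idx L M k'') => Complex.exp ((Complex.I * ((X k'' ν' x' : ℝ) : ℂ) / ((lev L k'' : ℕ) : ℂ)) * ((s : ℝ) : ℂ))) k' x) := by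
    intro X k' x n
    simp only [zT]
    exact contDiff_zfield (fine (lev L k') M) (u := fun s : ℝ => (fun k'' ν' (x' : idx L M k'') => Complex.exp ((Complex.I * ((X k'' ν' x' : ℝ) : ℂ) / ((lev L k'' : ℕ) : ℂ)) * ((s
          : ℝ) : ℂ))) k') (fun ν' i => contDiff_expChart_entry _ n) _ x
  set PX : ((k : ℕ) → Fin d → (idx L M k → ℝ)) → ℕ → ℝ → Matrix (idx L M k) (idx L M k) ℂ := fun (X : (k : ℕ) → Fin d → (idx L M k → ℝ)) (j : ℕ) (v : ℝ) =>
      Pmodel L M (fun k' ν (x : idx L M k') => iteratedDeriv j (fun s : ℝ => connV L M (fun k'' ν' (x' : idx L M k'') => Complex.exp ((Complex.I * ((X k'' ν' x' : ℝ) : ℂ) / ((lev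
            L k'' : ℕ) : ℂ)) * ((s : ℝ) : ℂ))) k' ν x) v) k
        + (Pmodel L M (fun k' ν (x : idx L M k') => iteratedDeriv j (fun s : ℝ => connV L M (fun k'' ν' (x' : idx L M k'') => Complex.exp ((Complex.I * ((X k'' ν' x' : ℝ) : ℂ) /
              ((lev L k'' : ℕ) : ℂ)) * ((s : ℝ) : ℂ))) k' ν x) v) k)ᴴ
        + Matrix.diagonal ((fun k' (x : idx L M k') => iteratedDeriv j (fun s : ℝ => zT L M (fun k'' ν' (x' : idx L M k'') => Complex.exp ((Complex.I * ((X k'' ν' x' : ℝ) : ℂ) /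
              ((lev L k'' : ℕ) : ℂ)) * ((s : ℝ) : ℂ))) k' x) v) k) with hPX
  have hPd : ∀ X : (k : ℕ) → Fin d → (idx L M k → ℝ), ∀ j v, HasDerivAt (PX X j) (PX X (j + 1) v) v := fun X j v =>
    hasDerivAt_couplingLetter_curve L M (fun j s k' μ x => hasDerivAt_iteratedDeriv_scalar (hcV X k' μ x) j s) (fun j s k' x => hasDerivAt_iteratedDeriv_scalar (hcZ X k' x) j s) k
          j v
  -- order zero: the towers pass through `covPert (U^X_v)`; at `v = 0` all three and the two-parameter chart sit at `U = 1`
  have eX : ∀ (X : (k : ℕ) → Fin d → (idx L M k → ℝ)) (v : ℝ), PX X 0 v = covPert L M (fun k'' ν' (x' : idx L M k'') => Complex.exp ((Complex.I * ((X k'' ν' x' : ℝ) : ℂ) / ((lev L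
        k'' : ℕ) : ℂ)) * ((v : ℝ) : ℂ))) k := by
    intro X v
    simp only [hPX, iteratedDeriv_zero]
    exact (covPert_eq L M _ k).symm
  have hA0 : PX A 0 0 = covPert L M (fun k'' ν' (x' : idx L M k'') => Complex.exp ((Complex.I * (A k'' ν' x' : ℂ) / ((lev L k'' : ℕ) : ℂ)) * ((0 : ℝ) : ℂ) + (Complex.I * (B k'' ν'
        x' : ℂ) / ((lev L k'' : ℕ) : ℂ)) * ((0 : ℝ) : ℂ))) k := by
    rw [eX, ← expChart₂_snd_zero L M A B 0]
  have hB0 : PX B 0 0 = covPert L M (fun k'' ν' (x' : idx L M k'') => Complex.exp ((Complex.I * (A k'' ν' x' : ℂ) / ((lev L k'' : ℕ) : ℂ)) * ((0 : ℝ) : ℂ) + (Complex.I * (B k'' ν'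
        x' : ℂ) / ((lev L k'' : ℕ) : ℂ)) * ((0 : ℝ) : ℂ))) k := by
    rw [eX, ← expChart₂_fst_zero L M A B 0]
  have hAB0 : PX (fun k ν x => A k ν x + B k ν x) 0 0 = covPert L M (fun k'' ν' (x' : idx L M k'') => Complex.exp ((Complex.I * (A k'' ν' x' : ℂ) / ((lev L k'' : ℕ) : ℂ)) * ((0 :
        ℝ) : ℂ) + (Complex.I * (B k'' ν' x' : ℂ) / ((lev L k'' : ℕ) : ℂ)) * ((0 : ℝ) : ℂ))) k := by
    rw [eX, ← expChart₂_diag L M A B 0]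
  -- order one: `−iA`, `−iB`, `−i(A + B) = −iA + (−iB)`; the zeroth-order first jets vanish
  have dz : Matrix.diagonal (fun _ : idx L M k => (0 : ℂ)) = 0 := Matrix.diagonal_zero
  have jV1A : (fun k' ν (x : idx L M k') => iteratedDeriv 1 (fun s : ℝ => connV L M (fun k'' ν' (x' : idx L M k'') => Complex.exp ((Complex.I * ((A k'' ν' x' : ℝ) : ℂ) / ((lev L
        k'' : ℕ) : ℂ)) * ((s : ℝ) : ℂ))) k' ν x) 0)
      = fun k' ν x => -(Complex.I * ((A k' ν x : ℝ) : ℂ)) := jetV_one_expChart L M A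
  have jV1B : (fun k' ν (x : idx L M k') => iteratedDeriv 1 (fun s : ℝ => connV L M (fun k'' ν' (x' : idx L M k'') => Complex.exp ((Complex.I * ((B k'' ν' x' : ℝ) : ℂ) / ((lev L
        k'' : ℕ) : ℂ)) * ((s : ℝ) : ℂ))) k' ν x) 0)
      = fun k' ν x => -(Complex.I * ((B k' ν x : ℝ) : ℂ)) := jetV_one_expChart L M B
  have jV1AB : (fun k' ν (x : idx L M k') => iteratedDeriv 1 (fun s : ℝ => connV L M (fun k'' ν' (x' : idx L M k'') => Complex.exp ((Complex.I * ((A k'' ν' x' + B k'' ν' x' : ℝ) :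
        ℂ) / ((lev L k'' : ℕ) : ℂ)) * ((s : ℝ) : ℂ))) k' ν x) 0)
      = fun k' ν x => -(Complex.I * ((A k' ν x + B k' ν x : ℝ) : ℂ)) :=
    jetV_one_expChart L M (fun k ν x => A k ν x + B k ν x)
  have jZ1A : (fun (x : idx L M k) => iteratedDeriv 1 (fun s : ℝ => zT L M (fun k'' ν' (x' : idx L M k'') => Complex.exp ((Complex.I * ((A k'' ν' x' : ℝ) : ℂ) / ((lev L k'' : ℕ) :
        ℂ)) * ((s : ℝ) : ℂ))) k x) 0) = fun _ => (0 : ℂ) := congrFun (expJetZ_eq_zero_one L M A 1 le_rfl) k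
  have jZ1B : (fun (x : idx L M k) => iteratedDeriv 1 (fun s : ℝ => zT L M (fun k'' ν' (x' : idx L M k'') => Complex.exp ((Complex.I * ((B k'' ν' x' : ℝ) : ℂ) / ((lev L k'' : ℕ) :
        ℂ)) * ((s : ℝ) : ℂ))) k x) 0) = fun _ => (0 : ℂ) := congrFun (expJetZ_eq_zero_one L M B 1 le_rfl) k
  have jZ1AB : (fun (x : idx L M k) => iteratedDeriv 1 (fun s : ℝ => zT L M (fun k'' ν' (x' : idx L M k'') => Complex.exp ((Complex.I * ((A k'' ν' x' + B k'' ν' x' : ℝ) : ℂ) /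
        ((lev L k'' : ℕ) : ℂ)) * ((s : ℝ) : ℂ))) k x) 0) = fun _ => (0 : ℂ) :=
    congrFun (expJetZ_eq_zero_one L M (fun k ν x => A k ν x + B k ν x) 1 le_rfl) k
  have hA1 : PX A 1 0 = Pmodel L M (fun k'' ν' (x' : idx L M k'') => -(Complex.I * (A k'' ν' x' : ℂ))) k + (Pmodel L M (fun k'' ν' (x' : idx L M k'') => -(Complex.I * (A k'' ν' x'
        : ℂ))) k)ᴴ
      + Matrix.diagonal (fun _ : idx L M k => (0 : ℂ)) := by
    simp only [hPX]
    rw [jV1A, jZ1A]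
  have hB1 : PX B 1 0 = Pmodel L M (fun k'' ν' (x' : idx L M k'') => -(Complex.I * (B k'' ν' x' : ℂ))) k + (Pmodel L M (fun k'' ν' (x' : idx L M k'') => -(Complex.I * (B k'' ν' x'
        : ℂ))) k)ᴴ
      + Matrix.diagonal (fun _ : idx L M k => (0 : ℂ)) := by
    simp only [hPX]
    rw [jV1B, jZ1B]
  have hAB1 : PX (fun k ν x => A k ν x + B k ν x) 1 0
      = (Pmodel L M (fun k'' ν' (x' : idx L M k'') => -(Complex.I * (A k'' ν' x' : ℂ))) k + (Pmodel L M (fun k'' ν' (x' : idx L M k'') => -(Complex.I * (A k'' ν' x' : ℂ))) k)ᴴ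
          + Matrix.diagonal (fun _ : idx L M k => (0 : ℂ)))
        + (Pmodel L M (fun k'' ν' (x' : idx L M k'') => -(Complex.I * (B k'' ν' x' : ℂ))) k + (Pmodel L M (fun k'' ν' (x' : idx L M k'') => -(Complex.I * (B k'' ν' x' : ℂ))) k)ᴴ
          + Matrix.diagonal (fun _ : idx L M k => (0 : ℂ))) := by
    simp only [hPX]
    rw [jV1AB, jZ1AB, jetV_one_add L M A B, Pmodel_add', Matrix.conjTranspose_add]
    simp only [dz, add_zero]
    abel
  -- order two: `a₂ + 2c + b₂` (PART 247's closed forms, PART 253's polarisation identities and additivity of the coupling letter)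
  have jV2A : (fun k' ν (x : idx L M k') => iteratedDeriv 2 (fun s : ℝ => connV L M (fun k'' ν' (x' : idx L M k'') => Complex.exp ((Complex.I * ((A k'' ν' x' : ℝ) : ℂ) / ((lev L
        k'' : ℕ) : ℂ)) * ((s : ℝ) : ℂ))) k' ν x) 0)
      = fun k' ν x => -((Complex.I * ((A k' ν x : ℝ) : ℂ)) ^ (1 + 1) / ((lev L k' : ℕ) : ℂ) ^ 1) := expJetV_eq L M A 1
  have jV2B : (fun k' ν (x : idx L M k') => iteratedDeriv 2 (fun s : ℝ => connV L M (fun k'' ν' (x' : idx L M k'') => Complex.exp ((Complex.I * ((B k'' ν' x' : ℝ) : ℂ) / ((lev L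
        k'' : ℕ) : ℂ)) * ((s : ℝ) : ℂ))) k' ν x) 0)
      = fun k' ν x => -((Complex.I * ((B k' ν x : ℝ) : ℂ)) ^ (1 + 1) / ((lev L k' : ℕ) : ℂ) ^ 1) := expJetV_eq L M B 1
  have jV2AB : (fun k' ν (x : idx L M k') => iteratedDeriv 2 (fun s : ℝ => connV L M (fun k'' ν' (x' : idx L M k'') => Complex.exp ((Complex.I * ((A k'' ν' x' + B k'' ν' x' : ℝ) :
        ℂ) / ((lev L k'' : ℕ) : ℂ)) * ((s : ℝ) : ℂ))) k' ν x) 0)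
      = fun k' ν x => -((Complex.I * ((A k' ν x + B k' ν x : ℝ) : ℂ)) ^ (1 + 1) / ((lev L k' : ℕ) : ℂ) ^ 1) :=
    expJetV_eq L M (fun k ν x => A k ν x + B k ν x) 1
  have jZ2A : (fun (x : idx L M k) => iteratedDeriv 2 (fun s : ℝ => zT L M (fun k'' ν' (x' : idx L M k'') => Complex.exp ((Complex.I * ((A k'' ν' x' : ℝ) : ℂ) / ((lev L k'' : ℕ) :
        ℂ)) * ((s : ℝ) : ℂ))) k x) 0)
      = fun x => -((∑ ν, ((Complex.I * ((A k ν x : ℝ) : ℂ)) ^ (0 + 2) + (-(Complex.I * ((A k ν x : ℝ) : ℂ))) ^ (0 + 2))) / ((lev L k : ℕ) : ℂ) ^ 0) := congrFun (expJetZ_eq L M A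
            0) k
  have jZ2B : (fun (x : idx L M k) => iteratedDeriv 2 (fun s : ℝ => zT L M (fun k'' ν' (x' : idx L M k'') => Complex.exp ((Complex.I * ((B k'' ν' x' : ℝ) : ℂ) / ((lev L k'' : ℕ) :
        ℂ)) * ((s : ℝ) : ℂ))) k x) 0)
      = fun x => -((∑ ν, ((Complex.I * ((B k ν x : ℝ) : ℂ)) ^ (0 + 2) + (-(Complex.I * ((B k ν x : ℝ) : ℂ))) ^ (0 + 2))) / ((lev L k : ℕ) : ℂ) ^ 0) := congrFun (expJetZ_eq L M B
            0) k
  have jZ2AB : (fun (x : idx L M k) => iteratedDeriv 2 (fun s : ℝ => zT L M (fun k'' ν' (x' : idx L M k'') => Complex.exp ((Complex.I * ((A k'' ν' x' + B k'' ν' x' : ℝ) : ℂ) /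
        ((lev L k'' : ℕ) : ℂ)) * ((s : ℝ) : ℂ))) k x) 0)
      = fun x => -((∑ ν, ((Complex.I * ((A k ν x + B k ν x : ℝ) : ℂ)) ^ (0 + 2) + (-(Complex.I * ((A k ν x + B k ν x : ℝ) : ℂ))) ^ (0 + 2))) / ((lev L k : ℕ) : ℂ) ^ 0) :=
    congrFun (expJetZ_eq L M (fun k ν x => A k ν x + B k ν x) 0) k
  have hAB2 : PX (fun k ν x => A k ν x + B k ν x) 2 0
      = PX A 2 0 + (2 : ℂ) • (Pmodel L M (fun k'' ν' (x' : idx L M k'') => -(Complex.I * (A k'' ν' x' : ℂ)) * (Complex.I * (B k'' ν' x' : ℂ) / ((lev L k'' : ℕ) : ℂ))) k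
          + (Pmodel L M (fun k'' ν' (x' : idx L M k'') => -(Complex.I * (A k'' ν' x' : ℂ)) * (Complex.I * (B k'' ν' x' : ℂ) / ((lev L k'' : ℕ) : ℂ))) k)ᴴ
          + Matrix.diagonal (fun x' : idx L M k => -2 * ∑ ν, (Complex.I * (A k ν x' : ℂ)) * (Complex.I * (B k ν x' : ℂ)))) + PX B 2 0 := by
    simp only [hPX]
    rw [jV2AB, jZ2AB, jV2A, jZ2A, jV2B, jZ2B, jetV_two_add L M A B, congrFun (jetZ_two_add L M A B) k]
    rw [couplingLetter_add L M (fun k ν (x : idx L M k) => -((Complex.I * (A k ν x : ℂ)) ^ (1 + 1) / ((lev L k : ℕ) : ℂ) ^ 1)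
          + 2 * (-(Complex.I * (A k ν x : ℂ)) * (Complex.I * (B k ν x : ℂ) / ((lev L k : ℕ) : ℂ))))
        (fun k ν (x : idx L M k) => -((Complex.I * (B k ν x : ℂ)) ^ (1 + 1) / ((lev L k : ℕ) : ℂ) ^ 1))
        (fun k (x : idx L M k) => -((∑ ν, ((Complex.I * (A k ν x : ℂ)) ^ (0 + 2) + (-(Complex.I * (A k ν x : ℂ))) ^ (0 + 2))) / ((lev L k : ℕ) : ℂ) ^ 0)
          + 2 * (-2 * ∑ ν, (Complex.I * (A k ν x : ℂ)) * (Complex.I * (B k ν x : ℂ))))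
        (fun k (x : idx L M k) => -((∑ ν, ((Complex.I * (B k ν x : ℂ)) ^ (0 + 2) + (-(Complex.I * (B k ν x : ℂ))) ^ (0 + 2))) / ((lev L k : ℕ) : ℂ) ^ 0)) k,
      couplingLetter_add L M (fun k ν (x : idx L M k) => -((Complex.I * (A k ν x : ℂ)) ^ (1 + 1) / ((lev L k : ℕ) : ℂ) ^ 1))
        (fun k ν (x : idx L M k) => 2 * (-(Complex.I * (A k ν x : ℂ)) * (Complex.I * (B k ν x : ℂ) / ((lev L k : ℕ) : ℂ))))
        (fun k (x : idx L M k) => -((∑ ν, ((Complex.I * (A k ν x : ℂ)) ^ (0 + 2) + (-(Complex.I * (A k ν x : ℂ))) ^ (0 + 2))) / ((lev L k : ℕ) : ℂ) ^ 0))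
        (fun k (x : idx L M k) => 2 * (-2 * ∑ ν, (Complex.I * (A k ν x : ℂ)) * (Complex.I * (B k ν x : ℂ)))) k,
      couplingLetter_two_mul L M (fun k ν (x : idx L M k) => -(Complex.I * (A k ν x : ℂ)) * (Complex.I * (B k ν x : ℂ) / ((lev L k : ℕ) : ℂ)))
        (fun k (x : idx L M k) => -2 * ∑ ν, (Complex.I * (A k ν x : ℂ)) * (Complex.I * (B k ν x : ℂ))) k]
  -- base-point invertibility and the read-out
  have h00 : covPert L M (fun k'' ν' (x' : idx L M k'') => Complex.exp ((Complex.I * (A k'' ν' x' : ℂ) / ((lev L k'' : ℕ) : ℂ)) * ((0 : ℝ) : ℂ) + (Complex.I * (B k'' ν' x' : ℂ) /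
        ((lev L k'' : ℕ) : ℂ)) * ((0 : ℝ) : ℂ))) k = 0 :=
    covPert_expChart₂_zero_zero L M A B k
  have ec : Φ (calGlev L M a ha k) = unitCovB L M a ha k := (hΦ (calGlev L M a ha)).symm
  have h0 : IsUnit (calDalev L M a ha k + covPert L M (fun k'' ν' (x' : idx L M k'') => Complex.exp ((Complex.I * (A k'' ν' x' : ℂ) / ((lev L k'' : ℕ) : ℂ)) * ((0 : ℝ) : ℂ) +
        (Complex.I * (B k'' ν' x' : ℂ) / ((lev L k'' : ℕ) : ℂ)) * ((0 : ℝ) : ℂ))) k).det := by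
    rw [h00, add_zero]
    exact isUnit_det_calDalev L M a ha k
  have hc0 : IsUnit (Φ (calDalev L M a ha k + covPert L M (fun k'' ν' (x' : idx L M k'') => Complex.exp ((Complex.I * (A k'' ν' x' : ℂ) / ((lev L k'' : ℕ) : ℂ)) * ((0 : ℝ) : ℂ) +
        (Complex.I * (B k'' ν' x' : ℂ) / ((lev L k'' : ℕ) : ℂ)) * ((0 : ℝ) : ℂ))) k)⁻¹).det := by
    rw [h00, add_zero, calDalev_inv, ec]
    exact (isUnit_det_unitCovB_and_opNorm_inv_le L M a ha k).1
  have hF : ∀ s r : ℝ, (avgTow (QBlev L M) ((L : ℝ) ^ d) (fun k' => (calDalev L M a ha k' + covPert L M (fun k'' ν' (x' : idx L M k'') => Complex.exp ((Complex.I * (A k'' ν' x' :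
        ℂ) / ((lev L k'' : ℕ) : ℂ)) * ((s : ℝ) : ℂ) + (Complex.I * (B k'' ν' x' : ℂ) / ((lev L k'' : ℕ) : ℂ)) * ((r : ℝ) : ℂ))) k')⁻¹) k)⁻¹
      = (Φ (calDalev L M a ha k + covPert L M (fun k'' ν' (x' : idx L M k'') => Complex.exp ((Complex.I * (A k'' ν' x' : ℂ) / ((lev L k'' : ℕ) : ℂ)) * ((s : ℝ) : ℂ) + (Complex.I *
            (B k'' ν' x' : ℂ) / ((lev L k'' : ℕ) : ℂ)) * ((r : ℝ) : ℂ))) k)⁻¹)⁻¹ := fun s r => by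
    rw [hΦ]
  have hFX : ∀ (X : (k : ℕ) → Fin d → (idx L M k → ℝ)) (v : ℝ), (avgTow (QBlev L M) ((L : ℝ) ^ d) (fun k' => (calDalev L M a ha k' + covPert L M (fun k'' ν' (x' : idx L M k'') =>
        Complex.exp ((Complex.I * ((X k'' ν' x' : ℝ) : ℂ) / ((lev L k'' : ℕ) : ℂ)) * ((v : ℝ) : ℂ))) k')⁻¹) k)⁻¹
      = (Φ (calDalev L M a ha k + PX X 0 v)⁻¹)⁻¹ := fun X v => by
    rw [hΦ, eX]
  simp only [hF, hFX A, hFX B, hFX (fun k ν x => A k ν x + B k ν x)]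
  exact deriv_deriv_eq_half_polarisation (calDalev L M a ha k) Φ (fun r => hasDerivAt_covPert_expChart₂_fst L M A B r k) (mixedLetter_fst_zero L M A B k)
    (hasDerivAt_covPert_expChart₂_snd_zero L M A B k) (hasDerivAt_mixedLetter L M A B k) h0 hc0 (hPd A) (hPd B) (hPd (fun k ν x => A k ν x + B k ν x)) hA0 hB0 hAB0 hA1 hB1 hAB1
          hAB2

end Summit.QuantumFields.BalabanUV.Beta.GAN24.ExponentialChartPolarisation

end
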